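import Summits.Ventures.HSemireg.WalshParityTwoLetter

/-!
# Venture HSemireg — t-20's TWO-LETTER LEMMA (family B, g = 8, §2.4 (b)) for every n, part 2: POSITIVITY — for n ≥ 3 an EFFECTIVE
# two-letter design with all steps odd and vanishing mixed moments is identically zero; hence (any steps) an effective two-letter design
# with vanishing mixed moments is W-DEAD — the door statement of census row B20-8 at the level of designs

HONEST FRAMING. Part of the Lean index of the computation cell `pub-hsemireg` (Sunday typer seat p9, § g = 8; family B rows **B20-k** of
`target-g8/CENSUS.md` v1.274 `7744dc4867915f69`, ENGINE-DOOR ROW **B20-8** «configurations Φ⁻¹(coordinate arrangement in E⁸) for ONE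
isogeny Φ : A₀ → E⁸ = designs with ≤ 2 unit letters per factor + pt/E² fillers | A₀, n ≥ 3 | — | never EXACT ∧ W-ALIVE (LEMMA §2.4(b));
n = 2: exactly Z₂»). FINITE GAUSSIAN-INTEGER ARITHMETIC ONLY, continuing `WalshParityTwoLetter.lean` (vocabulary `pt`, `cy`, the two-letter hypothesis,
`qfun`, parity constancy `qfun_eq_of_parity`, even-step lemma `moment_zero_eq_zero_of_even_step`). No abelian variety, isogeny, graph,
cycle, class or filler is constructed; LEMMA W and the isogeny dictionary stay TEXT OF RECORD, not binders and not proved here; nothing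
here says that HC ∕ HC_CM ∕ HC_AV holds; no object is certified; no Literature fact is declared.

TEXT OF RECORD (quoted, not interpreted). Source: t-20, `target-g8/FAMILY-B-G8-t20.md` v1.25 `987a3ee140325c40`, §2.4 (b): «TWO LETTERS
PER FACTOR: if every factor uses only two unit letters {ζ_k, ζ_k i^{d_k}} then (flipping one sign of ε shows) every d_k is odd, the 16
full moments become a multilinear function on {±1}⁴ that must be supported on an antipodal pair, and positivity of m forces m ≡ 0 for
n ≥ 3 (at n = 2 it gives exactly Z₂ = {(1,1),(i,−i)}). So no W-alive exact effective design lives in a product of 2-letter alphabets for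
n ≥ 3 …»

WHAT THIS FILE PROVES. `ind T` (indicator parameters), `cy_ind` (c(1_T) = Π_{k ∈ T} i^{d_k}), `sum_ind` (|1_T| = #T), `exists_sign_of_odd`
(an odd step is ±i); **`eq_zero_of_twoLetter_odd`**: n ≥ 3, all steps odd, m ≥ 0 two-letter with mixed moments 0 ⇒ m ≡ 0 — with three
factors 0, 1, 2 the classes ∅, {0,1}, {0,2}, {1,2} (even) and {0}, {1}, {2}, {0,1,2} (odd), parity constancy of q and the signs
i^{d_j} i^{d_k} = −s_j s_k, i^{d_0} i^{d_1} i^{d_2} = −s_0 s_1 s_2·i contradict m ≥ 0 unless m(a) = m(a + d_0 e_0) = 0, whence every q(y)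
vanishes; and the door statement **`moment_zero_eq_zero_of_twoLetter`**: for n ≥ 3 and ANY steps (d_k = 0 = a one-letter factor, so
«≤ 2 unit letters per factor» as the row says), an effective two-letter design
with mixed moments 0 is W-DEAD (m̂(+,…,+) = 0) — «never EXACT ∧ W-ALIVE» of row B20-8 at the level of designs (exact ⟺ mixed moments 0
and W-alive ⟺ m̂(+,…,+) ≠ 0 is LEMMA W, the dictionary, not proved here); and the n = 2 clause **`twoLetter_two`**: an effective
two-letter design on (ℤ∕4)² with both mixed moments zero and m̂(+,+) ≠ 0 is a positive constant on a pair {x, x + (1,3)} and zero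
elsewhere («at n = 2 it gives exactly Z₂ = {(1,1),(i,−i)}», up to the common unit letter i^x).

WHAT IS NOT HERE. LEMMA W and the isogeny dictionary; fillers; any sheaf or class computation.
-/

namespace Summit.Ventures.HSemireg.WalshParityN

open Finset

variable {n : ℕ}

/-! ## §4 Positivity: n ≥ 3, all steps odd ⇒ m ≡ 0; the door statement -/

/-- The indicator parameter of a set of factors. [definition of this file] -/
def ind (T : Finset (Fin n)) : Sgn n := fun k => if k ∈ T then 1 else 0

/-- `c(1_T) = Π_{k ∈ T} i^{d_k}`. -/
theorem cy_ind (d : Fin n → Fin 4) (T : Finset (Fin n)) : cy d (ind T) = ∏ k ∈ T, I ^ (d k).val := by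
  unfold cy ind
  rw [← Finset.prod_filter]
  congr 1
  ext k
  simp

/-- `|1_T| ≡ #T (mod 2)` — in fact `Σ_k (1_T)_k = #T`. -/
theorem sum_ind (T : Finset (Fin n)) : (∑ k, (ind T k).val) = T.card := by
  unfold ind
  have h : ∀ k : Fin n, ((if k ∈ T then (1 : Fin 2) else 0).val) = if k ∈ T then 1 else 0 := by
    intro k; split_ifs <;> rfl
  simp_rw [h]
  rw [Finset.sum_ite_mem, Finset.univ_inter, Finset.card_eq_sum_ones]

/-- An odd step is `i` or `−i`: `i^{d} = s·i` with `s = ±1`. -/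
theorem exists_sign_of_odd (v : Fin 4) (hv : v.val % 2 = 1) : ∃ s : ℤ, (s = 1 ∨ s = -1) ∧ I ^ v.val = (s : GaussianInt) * I := by
  have h4 := v.isLt
  have : v.val = 1 ∨ v.val = 3 := by omega
  rcases this with h | h
  · exact ⟨1, Or.inl rfl, by simp [h]⟩
  · exact ⟨-1, Or.inr rfl, by simp [h, (by decide : I ^ 3 = -I)]⟩

/-- Integer equations from Gaussian-integer ones. -/
theorem int_eq_of_cast_mul_I_eq {u v : ℤ} (h : (u : GaussianInt) * I = (v : GaussianInt) * I) : u = v := by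
  have hI : I ≠ 0 := by decide
  have := mul_right_cancel₀ hI h
  exact_mod_cast this

/-- **n ≥ 3, ALL STEPS ODD ⇒ AN EFFECTIVE TWO-LETTER DESIGN WITH VANISHING MIXED MOMENTS IS ZERO** («positivity of m forces m ≡ 0 for
n ≥ 3»): with three factors 0, 1, 2 the parity classes of (ℤ∕2)ⁿ contain ∅, {0,1}, {0,2}, {1,2} (even) and {0}, {1}, {2}, {0,1,2} (odd);
parity constancy of q and the signs `i^{d_j} i^{d_k} = −s_j s_k`, `i^{d_0} i^{d_1} i^{d_2} = −s_0 s_1 s_2·i` contradict `m ≥ 0` unless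
`m(a) = m(a + d_0 e_0) = 0`, whence every q(y) vanishes. -/
theorem eq_zero_of_twoLetter_odd (hn : 3 ≤ n) (a : Letter n) (d : Fin n → Fin 4) (hodd : ∀ k, (d k).val % 2 = 1)
    (m : Letter n → ℤ) (hpos : ∀ x, 0 ≤ m x) (h : ∀ x : Letter n, m x ≠ 0 → ∀ k, x k = a k ∨ x k = a k + d k)
    (hmixed : ∀ δ : Sgn n, δ ≠ 0 → δ ≠ 1 → moment m δ = 0) : ∀ x, m x = 0 := by
  have hn0 : 0 < n := by omega
  set j0 : Fin n := ⟨0, by omega⟩ with hj0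
  set j1 : Fin n := ⟨1, by omega⟩ with hj1
  set j2 : Fin n := ⟨2, by omega⟩ with hj2
  have h01 : j0 ≠ j1 := by rw [hj0, hj1]; intro h; have := congrArg Fin.val h; simp at this
  have h02 : j0 ≠ j2 := by rw [hj0, hj2]; intro h; have := congrArg Fin.val h; simp at this
  have h12 : j1 ≠ j2 := by rw [hj1, hj2]; intro h; have := congrArg Fin.val h; simp at this
  obtain ⟨s0, hs0, hI0⟩ := exists_sign_of_odd (d j0) (hodd j0)
  obtain ⟨s1, hs1, hI1⟩ := exists_sign_of_odd (d j1) (hodd j1)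
  obtain ⟨s2, hs2, hI2⟩ := exists_sign_of_odd (d j2) (hodd j2)
  -- parity constancy on the eight test parameters
  have hq := qfun_eq_of_parity hn0 a d hodd m h hmixed
  have hpar : ∀ T T' : Finset (Fin n), T.card % 2 = T'.card % 2 → qfun a d m (ind T) = qfun a d m (ind T') := by
    intro T T' hTT'
    exact hq (ind T) (ind T') (by rw [sum_ind, sum_ind, hTT'])
  -- the values M_T = m(a + 1_T·d) and the units c(1_T)
  have hq_val : ∀ T : Finset (Fin n), qfun a d m (ind T) = (m (pt a d (ind T)) : GaussianInt) * ∏ k ∈ T, I ^ (d k).val := by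
    intro T; rw [qfun, cy_ind]
  have hc0 : (∏ k ∈ (∅ : Finset (Fin n)), I ^ (d k).val) = 1 := Finset.prod_empty
  have hc1 : ∀ j : Fin n, (∏ k ∈ ({j} : Finset (Fin n)), I ^ (d k).val) = I ^ (d j).val := fun j => Finset.prod_singleton _ _
  have hc2 : ∀ j k : Fin n, j ≠ k → (∏ l ∈ ({j, k} : Finset (Fin n)), I ^ (d l).val) = I ^ (d j).val * I ^ (d k).val := by
    intro j k hjk
    rw [Finset.prod_insert (by simp [hjk]), Finset.prod_singleton]
  have hc3 : (∏ l ∈ ({j0, j1, j2} : Finset (Fin n)), I ^ (d l).val) = I ^ (d j0).val * (I ^ (d j1).val * I ^ (d j2).val) := by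
    rw [Finset.prod_insert (by simp [h01, h02]), Finset.prod_insert (by simp [h12]), Finset.prod_singleton]
  have hcard2 : ∀ j k : Fin n, j ≠ k → ({j, k} : Finset (Fin n)).card = 2 := fun j k hjk => by
    rw [Finset.card_insert_of_notMem (by simp [hjk]), Finset.card_singleton]
  have hcard3 : ({j0, j1, j2} : Finset (Fin n)).card = 3 := by
    rw [Finset.card_insert_of_notMem (by simp [h01, h02]), Finset.card_insert_of_notMem (by simp [h12]), Finset.card_singleton]
  -- abbreviations for the eight multiplicities
  set Me := m (pt a d (ind ∅)) with hMe
  set M01 := m (pt a d (ind {j0, j1})) with hM01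
  set M02 := m (pt a d (ind {j0, j2})) with hM02
  set M12 := m (pt a d (ind {j1, j2})) with hM12
  set M0 := m (pt a d (ind {j0})) with hM0
  set M1 := m (pt a d (ind {j1})) with hM1
  set M2 := m (pt a d (ind {j2})) with hM2
  set M012 := m (pt a d (ind {j0, j1, j2})) with hM012
  -- EVEN equations: Me = −s_j s_k M_jk
  have hE : ∀ (j k : Fin n) (sj sk : ℤ), j ≠ k → I ^ (d j).val = (sj : GaussianInt) * I → I ^ (d k).val = (sk : GaussianInt) * I →
      Me = -(sj * sk) * m (pt a d (ind {j, k})) := by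
    intro j k sj sk hjk hIj hIk
    have heq := hpar ∅ {j, k} (by rw [Finset.card_empty, hcard2 j k hjk])
    rw [hq_val, hq_val, hc0, hc2 j k hjk, hIj, hIk, mul_one] at heq
    have h2 : (Me : GaussianInt) = ((-(sj * sk) * m (pt a d (ind {j, k})) : ℤ) : GaussianInt) := by
      rw [heq]; push_cast
      have : (sj : GaussianInt) * I * ((sk : GaussianInt) * I) = (sj : GaussianInt) * sk * I ^ 2 := by ring
      rw [this, I_sq]; ring
    exact_mod_cast h2
  have hE01 := hE j0 j1 s0 s1 h01 hI0 hI1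
  have hE02 := hE j0 j2 s0 s2 h02 hI0 hI2
  have hE12 := hE j1 j2 s1 s2 h12 hI1 hI2
  -- ODD equations: M_j s_j = M_k s_k and M_0 s_0 = −s_0 s_1 s_2 M_012
  have hO : ∀ (j k : Fin n) (sj sk : ℤ), I ^ (d j).val = (sj : GaussianInt) * I → I ^ (d k).val = (sk : GaussianInt) * I →
      m (pt a d (ind {j})) * sj = m (pt a d (ind {k})) * sk := by
    intro j k sj sk hIj hIk
    have heq := hpar {j} {k} (by rw [Finset.card_singleton, Finset.card_singleton])
    rw [hq_val, hq_val, hc1, hc1, hIj, hIk] at heq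
    apply int_eq_of_cast_mul_I_eq
    push_cast
    calc (m (pt a d (ind {j})) : GaussianInt) * sj * I = (m (pt a d (ind {j})) : GaussianInt) * ((sj : GaussianInt) * I) := by ring
      _ = (m (pt a d (ind {k})) : GaussianInt) * ((sk : GaussianInt) * I) := heq
      _ = (m (pt a d (ind {k})) : GaussianInt) * sk * I := by ring
  have hO01 := hO j0 j1 s0 s1 hI0 hI1
  have hO02 := hO j0 j2 s0 s2 hI0 hI2
  have hO012 : M0 * s0 = -(s0 * s1 * s2) * M012 := by
    have heq := hpar {j0} {j0, j1, j2} (by rw [Finset.card_singleton, hcard3])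
    rw [hq_val, hq_val, hc1, hc3, hI0, hI1, hI2] at heq
    apply int_eq_of_cast_mul_I_eq
    push_cast
    have hI3 : (s0 : GaussianInt) * I * ((s1 : GaussianInt) * I * ((s2 : GaussianInt) * I))
        = -((s0 : GaussianInt) * s1 * s2) * I := by
      have : (s0 : GaussianInt) * I * ((s1 : GaussianInt) * I * ((s2 : GaussianInt) * I))
          = (s0 : GaussianInt) * s1 * s2 * I * I ^ 2 := by ring
      rw [this, I_sq]; ring
    calc (M0 : GaussianInt) * s0 * I = (M0 : GaussianInt) * ((s0 : GaussianInt) * I) := by ring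
      _ = (M012 : GaussianInt) * ((s0 : GaussianInt) * I * ((s1 : GaussianInt) * I * ((s2 : GaussianInt) * I))) := heq
      _ = -(↑s0 * ↑s1 * ↑s2) * ↑M012 * I := by rw [hI3]; ring
  -- positivity kills everything
  have hMe0 : Me = 0 := by
    have p01 := hpos (pt a d (ind {j0, j1}))
    have p02 := hpos (pt a d (ind {j0, j2}))
    have p12 := hpos (pt a d (ind {j1, j2}))
    have pe := hpos (pt a d (ind ∅))
    rcases hs0 with r0 | r0 <;> rcases hs1 with r1 | r1 <;> rcases hs2 with r2 | r2 <;> subst r0 r1 r2 <;> omega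
  have hM00 : M0 = 0 := by
    have p0 := hpos (pt a d (ind {j0}))
    have p1 := hpos (pt a d (ind {j1}))
    have p2 := hpos (pt a d (ind {j2}))
    have p012 := hpos (pt a d (ind {j0, j1, j2}))
    rcases hs0 with r0 | r0 <;> rcases hs1 with r1 | r1 <;> rcases hs2 with r2 | r2 <;> subst r0 r1 r2 <;> omega
  -- hence q vanishes on both parity families, so m vanishes on the whole alphabet
  have hq0 : ∀ y : Sgn n, qfun a d m y = 0 := by
    intro y
    by_cases hy : (∑ k, (y k).val) % 2 = 0
    · rw [hq y (ind ∅) (by rw [hy, sum_ind, Finset.card_empty]), hq_val, hc0, ← hMe, hMe0]; simp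
    · rw [hq y (ind {j0}) (by rw [sum_ind, Finset.card_singleton]; omega), hq_val, hc1, ← hM0, hM00]; simp
  intro x
  by_contra hx
  obtain ⟨y, hy⟩ := exists_pt_of_twoLetter h x hx
  have := hq0 y
  rw [qfun, hy] at this
  rcases mul_eq_zero.mp this with h0 | h0
  · exact hx (by exact_mod_cast h0)
  · exact cy_ne_zero d y h0

/-- **THE DOOR STATEMENT OF ROW B20-8 AT THE LEVEL OF DESIGNS (every n ≥ 3, any steps — «≤ 2 unit letters per factor», a step
d_k = 0 being a one-letter factor):** an EFFECTIVE unit-graph design supported in a product of alphabets `{a_k, a_k + d_k}` whose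
mixed-sign full moments all vanish is W-DEAD:
`m̂(+,…,+) = 0` («no W-alive exact effective design lives in a product of 2-letter alphabets for n ≥ 3»; exactness ⟺ mixed moments 0 and
W-alive ⟺ m̂(+,…,+) ≠ 0 is LEMMA W, the dictionary, not proved here). If some step is 0 or 2 this is the even-step lemma (flip
that factor's sign); otherwise all steps are odd and the design is identically zero. -/
theorem moment_zero_eq_zero_of_twoLetter (hn : 3 ≤ n) (a : Letter n) (d : Fin n → Fin 4)
    (m : Letter n → ℤ) (hpos : ∀ x, 0 ≤ m x) (h : ∀ x : Letter n, m x ≠ 0 → ∀ k, x k = a k ∨ x k = a k + d k)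
    (hmixed : ∀ δ : Sgn n, δ ≠ 0 → δ ≠ 1 → moment m δ = 0) : moment m 0 = 0 := by
  by_cases heven : ∃ k₀, (d k₀).val % 2 = 0
  · -- an even step (d = 2) or a one-letter factor (d = 0): flip the sign of that factor
    obtain ⟨k₀, hk₀⟩ := heven
    have h02 : d k₀ = 0 ∨ d k₀ = 2 := by
      have h4 := (d k₀).isLt
      have : (d k₀).val = 0 ∨ (d k₀).val = 2 := by omega
      rcases this with h0 | h0
      · exact Or.inl (Fin.ext h0)
      · exact Or.inr (Fin.ext h0)
    refine moment_zero_eq_zero_of_even_step (by omega) m k₀ (a k₀) (fun x hx => ?_) hmixed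
    rcases h x hx k₀ with hx0 | hx0
    · exact Or.inl hx0
    · rcases h02 with h0 | h2
      · exact Or.inl (by rw [hx0, h0, add_zero])
      · exact Or.inr (by rw [hx0, h2])
  · push Not at heven
    have hodd : ∀ k, (d k).val % 2 = 1 := fun k => by have := heven k; omega
    have hzero := eq_zero_of_twoLetter_odd hn a d hodd m hpos h hmixed
    unfold moment
    exact Finset.sum_eq_zero (fun x _ => by rw [hzero x]; simp)

/-! ## §5 The case n = 2: «exactly Z₂» -/

/-- The four parameters of (ℤ∕2)². -/
theorem sgn_two_cases (y : Sgn 2) : y = ![0, 0] ∨ y = ![1, 0] ∨ y = ![0, 1] ∨ y = ![1, 1] := by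
  revert y
  decide

/-- From `i^{d} = s·i` read the odd step: `s = 1 ⇒ d = 1`, `s = −1 ⇒ d = 3`. -/
theorem step_of_sign (v : Fin 4) (hv : v.val % 2 = 1) (s : ℤ) (h : I ^ v.val = (s : GaussianInt) * I) :
    (s = 1 → v = 1) ∧ (s = -1 → v = 3) := by
  have h4 := v.isLt
  have hIneg : I ≠ -I := by decide
  have hv' : v.val = 1 ∨ v.val = 3 := by omega
  constructor
  · rintro rfl
    rcases hv' with e | e
    · exact Fin.ext e
    · exfalso; rw [e, (by decide : I ^ 3 = -I)] at h; simp at h; exact hIneg h.symm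
  · rintro rfl
    rcases hv' with e | e
    · exfalso; rw [e, pow_one] at h; simp at h; exact hIneg h
    · exact Fin.ext e

/-- **n = 2: «EXACTLY Z₂».** An EFFECTIVE two-letter design on (ℤ∕4)² with both mixed moments zero which is W-ALIVE (`m̂(+,+) ≠ 0`) is a
positive constant on an antipodal-type pair `{x, x + (1,3)}` (letters `ζ·(1,1)` and `ζ·(i,−i)` for a unit letter vector `ζ = i^x`) and
zero elsewhere — t-20's «at n = 2 it gives exactly Z₂ = {(1,1),(i,−i)}», up to the common unit. -/
theorem twoLetter_two (a : Letter 2) (d : Fin 2 → Fin 4) (m : Letter 2 → ℤ) (hpos : ∀ x, 0 ≤ m x) (h : ∀ x : Letter 2, m x ≠ 0 → ∀ k, x k = a k ∨ x k = a k + d k)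
    (hmixed : ∀ δ : Sgn 2, δ ≠ 0 → δ ≠ 1 → moment m δ = 0) (halive : moment m 0 ≠ 0) :
    ∃ x : Letter 2, 0 < m x ∧ m (x + ![1, 3]) = m x ∧ ∀ z : Letter 2, m z ≠ 0 → z = x ∨ z = x + ![1, 3] := by
  -- both steps are odd (an even step or a one-letter factor would make the design W-dead)
  have hodd : ∀ k, (d k).val % 2 = 1 := by
    intro k
    by_contra hk
    have h02 : d k = 0 ∨ d k = 2 := by
      have h4 := (d k).isLt
      have : (d k).val = 0 ∨ (d k).val = 2 := by omega
      rcases this with h0 | h0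
      · exact Or.inl (Fin.ext h0)
      · exact Or.inr (Fin.ext h0)
    refine halive (moment_zero_eq_zero_of_even_step (le_refl 2) m k (a k) (fun x hx => ?_) hmixed)
    rcases h x hx k with hx0 | hx0
    · exact Or.inl hx0
    · rcases h02 with h0 | h2
      · exact Or.inl (by rw [hx0, h0, add_zero])
      · exact Or.inr (by rw [hx0, h2])
  obtain ⟨s0, hs0, hI0⟩ := exists_sign_of_odd (d 0) (hodd 0)
  obtain ⟨s1, hs1, hI1⟩ := exists_sign_of_odd (d 1) (hodd 1)
  have hq := qfun_eq_of_parity (by norm_num) a d hodd m h hmixed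
  -- the four values of q
  have hc00 : cy d ![0, 0] = 1 := by simp [cy, Fin.prod_univ_two]
  have hc11 : cy d ![1, 1] = I ^ (d 0).val * I ^ (d 1).val := by simp [cy, Fin.prod_univ_two]
  have hc10 : cy d ![1, 0] = I ^ (d 0).val := by simp [cy, Fin.prod_univ_two]
  have hc01 : cy d ![0, 1] = I ^ (d 1).val := by simp [cy, Fin.prod_univ_two]
  have hE := hq ![0, 0] ![1, 1] (by simp)
  have hO := hq ![1, 0] ![0, 1] (by simp)
  simp only [qfun] at hE hO
  rw [hc00, hc11, hI0, hI1, mul_one] at hE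
  rw [hc10, hc01, hI0, hI1] at hO
  -- integer equations
  have hEi : m (pt a d ![0, 0]) = -(s0 * s1) * m (pt a d ![1, 1]) := by
    have h2 : (m (pt a d ![0, 0]) : GaussianInt) = ((-(s0 * s1) * m (pt a d ![1, 1]) : ℤ) : GaussianInt) := by
      rw [hE]; push_cast
      have : (s0 : GaussianInt) * I * ((s1 : GaussianInt) * I) = (s0 : GaussianInt) * s1 * I ^ 2 := by ring
      rw [this, I_sq]; ring
    exact_mod_cast h2
  have hOi : m (pt a d ![1, 0]) * s0 = m (pt a d ![0, 1]) * s1 := by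
    apply int_eq_of_cast_mul_I_eq
    push_cast
    calc (m (pt a d ![1, 0]) : GaussianInt) * s0 * I = (m (pt a d ![1, 0]) : GaussianInt) * ((s0 : GaussianInt) * I) := by ring
      _ = (m (pt a d ![0, 1]) : GaussianInt) * ((s1 : GaussianInt) * I) := hO
      _ = (m (pt a d ![0, 1]) : GaussianInt) * s1 * I := by ring
  have p00 := hpos (pt a d ![0, 0])
  have p11 := hpos (pt a d ![1, 1])
  have p10 := hpos (pt a d ![1, 0])
  have p01 := hpos (pt a d ![0, 1])
  -- every support letter is one of the four alphabet points
  have hfour : ∀ z : Letter 2, m z ≠ 0 →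
      z = pt a d ![0, 0] ∨ z = pt a d ![1, 0] ∨ z = pt a d ![0, 1] ∨ z = pt a d ![1, 1] := by
    intro z hz
    obtain ⟨y, rfl⟩ := exists_pt_of_twoLetter h z hz
    rcases sgn_two_cases y with rfl | rfl | rfl | rfl
    · exact Or.inl rfl
    · exact Or.inr (Or.inl rfl)
    · exact Or.inr (Or.inr (Or.inl rfl))
    · exact Or.inr (Or.inr (Or.inr rfl))
  -- W-alive: not all four values vanish
  have hsome : m (pt a d ![0, 0]) ≠ 0 ∨ m (pt a d ![1, 0]) ≠ 0 := by
    by_contra hno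
    push Not at hno
    apply halive
    unfold moment
    refine Finset.sum_eq_zero (fun z _ => ?_)
    by_cases hz : m z = 0
    · simp [hz]
    · exfalso
      rcases hfour z hz with rfl | rfl | rfl | rfl
      · exact hz hno.1
      · exact hz hno.2
      · apply hz
        rcases hs0 with r0 | r0 <;> rcases hs1 with r1 | r1 <;> subst r0 r1 <;> omega
      · apply hz
        rcases hs0 with r0 | r0 <;> rcases hs1 with r1 | r1 <;> subst r0 r1 <;> omega
  -- the steps as letters, from the signs
  have hd0 := step_of_sign (d 0) (hodd 0) s0 hI0
  have hd1 := step_of_sign (d 1) (hodd 1) s1 hI1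
  -- Fin 4 constants
  have c31 : (3 : Fin 4) + 1 = 0 := by decide
  have c13 : (1 : Fin 4) + 3 = 0 := by decide
  rcases hs0 with r0 | r0 <;> rcases hs1 with r1 | r1
  · -- s0 = 1, s1 = 1: the pair {a + (0, d 1), a + (d 0, 0)}, d = (1, 1)
    have e0 := hd0.1 r0; have e1 := hd1.1 r1
    subst r0 r1
    have hm00 : m (pt a d ![0, 0]) = 0 := by omega
    have hm11 : m (pt a d ![1, 1]) = 0 := by omega
    have hm10 : m (pt a d ![1, 0]) = m (pt a d ![0, 1]) := by omega
    have hpt' : pt a d ![0, 1] + ![1, 3] = pt a d ![1, 0] := by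
      funext k; fin_cases k <;> simp [pt, e0, e1, add_assoc, c13]
    refine ⟨pt a d ![0, 1], ?_, by rw [hpt', hm10], fun z hz => ?_⟩
    · rcases hsome with h0 | h0
      · exact absurd hm00 h0
      · have := p01; omega
    · rcases hfour z hz with rfl | rfl | rfl | rfl
      · exact absurd hm00 hz
      · exact Or.inr hpt'.symm
      · exact Or.inl rfl
      · exact absurd hm11 hz
  · -- s0 = 1, s1 = −1: the pair {a, a + d}, d = (1, 3)
    have e0 := hd0.1 r0; have e1 := hd1.2 r1
    subst r0 r1
    have hm10 : m (pt a d ![1, 0]) = 0 := by omega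
    have hm01 : m (pt a d ![0, 1]) = 0 := by omega
    have hm00 : m (pt a d ![0, 0]) = m (pt a d ![1, 1]) := by omega
    have hpt' : pt a d ![0, 0] + ![1, 3] = pt a d ![1, 1] := by
      funext k; fin_cases k <;> simp [pt, e0, e1]
    refine ⟨pt a d ![0, 0], ?_, by rw [hpt', hm00], fun z hz => ?_⟩
    · rcases hsome with h0 | h0
      · have := p00; omega
      · exact absurd hm10 h0
    · rcases hfour z hz with rfl | rfl | rfl | rfl
      · exact Or.inl rfl
      · exact absurd hm10 hz
      · exact absurd hm01 hz
      · exact Or.inr hpt'.symm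
  · -- s0 = −1, s1 = 1: the pair {a + d, a}, d = (3, 1)
    have e0 := hd0.2 r0; have e1 := hd1.1 r1
    subst r0 r1
    have hm10 : m (pt a d ![1, 0]) = 0 := by omega
    have hm01 : m (pt a d ![0, 1]) = 0 := by omega
    have hm00 : m (pt a d ![0, 0]) = m (pt a d ![1, 1]) := by omega
    have hpt' : pt a d ![1, 1] + ![1, 3] = pt a d ![0, 0] := by
      funext k; fin_cases k <;> simp [pt, e0, e1, add_assoc, c31, c13]
    refine ⟨pt a d ![1, 1], ?_, by rw [hpt', hm00], fun z hz => ?_⟩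
    · rcases hsome with h0 | h0
      · have := p11; omega
      · exact absurd hm10 h0
    · rcases hfour z hz with rfl | rfl | rfl | rfl
      · exact Or.inr hpt'.symm
      · exact absurd hm10 hz
      · exact absurd hm01 hz
      · exact Or.inl rfl
  · -- s0 = −1, s1 = −1: the pair {a + (d 0, 0), a + (0, d 1)}, d = (3, 3)
    have e0 := hd0.2 r0; have e1 := hd1.2 r1
    subst r0 r1
    have hm00 : m (pt a d ![0, 0]) = 0 := by omega
    have hm11 : m (pt a d ![1, 1]) = 0 := by omega
    have hm10 : m (pt a d ![1, 0]) = m (pt a d ![0, 1]) := by omega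
    have hpt' : pt a d ![1, 0] + ![1, 3] = pt a d ![0, 1] := by
      funext k; fin_cases k <;> simp [pt, e0, e1, add_assoc, c31]
    refine ⟨pt a d ![1, 0], ?_, by rw [hpt', hm10], fun z hz => ?_⟩
    · rcases hsome with h0 | h0
      · exact absurd hm00 h0
      · have := p10; omega
    · rcases hfour z hz with rfl | rfl | rfl | rfl
      · exact absurd hm00 hz
      · exact Or.inl rfl
      · exact Or.inr hpt'.symm
      · exact absurd hm11 hz

end Summit.Ventures.HSemireg.WalshParityN
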